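import Summits.HubbardSuperconductivity.HubbardLadder.Bounds.FdcEval2x2
import HarnessLib

/-!
# Kernel certificate `F31`, B-bond classes

HONEST FRAMING: ladder R1–R4 with certified numbers; no claim on H/H₀; bounds for model classes,
no materials claim.

Per B-bond class `(m, i)` (`m_i = 1`) and bond term `t`: the kernel evaluation of the integer B-sum `IB`. [folklore]
-/

namespace Summit.HubbardSuperconductivity.HubbardLadder.Bounds

/-- **Certified value** of the B-sum `IB 1 0 0` (2Sᶻ⊗2Sᶻ; kernel evaluation). [folklore] -/
theorem IB_eq_100 : IB 1 0 0 =
    (-4365196761261434154378404946208199708007389426360538448674816) := by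
  decide +kernel

/-- **Certified value** of the B-sum `IB 1 0 1` (S⁺⊗S⁻; kernel evaluation). [folklore] -/
theorem IB_eq_101 : IB 1 0 1 =
    (-891275209521381397869010304245010508028481583387392378142720) := by
  decide +kernel

/-- **Certified value** of the B-sum `IB 1 0 2` (S⁻⊗S⁺; kernel evaluation). [folklore] -/
theorem IB_eq_102 : IB 1 0 2 =
    (-891275209521381397869010304245010508028481583387392378142720) := by
  decide +kernel

/-- **Certified value** of the B-sum `IB 2 1 0` (2Sᶻ⊗2Sᶻ; kernel evaluation). [folklore] -/
theorem IB_eq_210 : IB 2 1 0 =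
    (-4361419585686486160295950663772052288813043035301222813679616) := by
  decide +kernel

/-- **Certified value** of the B-sum `IB 2 1 1` (S⁺⊗S⁻; kernel evaluation). [folklore] -/
theorem IB_eq_211 : IB 2 1 1 =
    (-893418711797158542781053267290127023213593657187475120906240) := by
  decide +kernel

/-- **Certified value** of the B-sum `IB 2 1 2` (S⁻⊗S⁺; kernel evaluation). [folklore] -/
theorem IB_eq_212 : IB 2 1 2 =
    (-893418711797158542781053267290127023213593657187475120906240) := by
  decide +kernel

/-- **Certified value** of the B-sum `IB 3 0 0` (2Sᶻ⊗2Sᶻ; kernel evaluation). [folklore] -/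
theorem IB_eq_300 : IB 3 0 0 =
    (-4365196761261434154378404946208199708007389426360538448674816) := by
  decide +kernel

/-- **Certified value** of the B-sum `IB 3 0 1` (S⁺⊗S⁻; kernel evaluation). [folklore] -/
theorem IB_eq_301 : IB 3 0 1 =
    (-891275209521381397869010304245010508028481583387392378142720) := by
  decide +kernel

/-- **Certified value** of the B-sum `IB 3 0 2` (S⁻⊗S⁺; kernel evaluation). [folklore] -/
theorem IB_eq_302 : IB 3 0 2 =
    (-891275209521381397869010304245010508028481583387392378142720) := by
  decide +kernel

/-- **Certified value** of the B-sum `IB 3 1 0` (2Sᶻ⊗2Sᶻ; kernel evaluation). [folklore] -/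
theorem IB_eq_310 : IB 3 1 0 =
    (-4361419585686486160295950663772052288813043035301222813679616) := by
  decide +kernel

/-- **Certified value** of the B-sum `IB 3 1 1` (S⁺⊗S⁻; kernel evaluation). [folklore] -/
theorem IB_eq_311 : IB 3 1 1 =
    (-893418711797158542781053267290127023213593657187475120906240) := by
  decide +kernel

/-- **Certified value** of the B-sum `IB 3 1 2` (S⁻⊗S⁺; kernel evaluation). [folklore] -/
theorem IB_eq_312 : IB 3 1 2 =
    (-893418711797158542781053267290127023213593657187475120906240) := by
  decide +kernel

end Summit.HubbardSuperconductivity.HubbardLadder.Bounds
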